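import Summits.NavierStokesRegularity.NavierStokesRegularity.Theorems.TypeICertificateLadderTargetRotatingConjugateDensityGradient
import Summits.NavierStokesRegularity.NavierStokesRegularity.Theorems.TypeICertificateLadderTargetRotatingConjugateDensityDecay
import Literature.Analysis.FluidPDE.PineauVicolRSSProofs
import HarnessLib

/-!
# The Gaussian gradient bound for the rotating conjugate density
# (tools for stub B2 of line `killing-twisted-bernoulli-solitons`, crux `Target`, stmt-NavierStokesRegularity-1217)

Helper file (all results proved, no definitions, no named facts). For the positive smooth solution
`v` of the rotating-gauge weight equation `N v = 0` (drift `½y + (U − α J)`, `J = rotGen`,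
`DriftHyp U C₀`, `‖DU‖ ≤ K`) obeying the upper Gaussian bound `v(z) ≤ V_b e^{3|z|²/16}` (which is
`γ v ≤ M e^{−|z|²/16}`), the weight `w = γ v` has a Gaussian gradient:
`γ(y) (‖Dv(y)‖ + ½|y| v(y)) ≤ M₂ e^{−|y|²/32}` for some `M₂` (`exists_gaussian_gradient_bound`).
Proof: the pointwise interior gradient bound `sq_norm_fderiv_le_of_laplacian_eq` on `B̄(y, 1)`
with the local sizes `B ∼ (C₀ + 1 + |α|)(1 + |y|)` of the drift, `Λ ∼ (K + C₀ + 1 + 2|α|)(2 + |y|)`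
of its derivative and `S = V_b e^{3(|y|+1)²/16}` of `v`, all of which grow at most like `e^{O(|y|)}`;
against `γ = e^{−|y|²/4}` this leaves `e^{−|y|²/16 + O(|y|)} ≤ C e^{−|y|²/32}`.

References: B. Pineau, V. Vicol, arXiv:2607.09619 (2026), Prop. 5.1 (the weight is `C²` with
Gaussian bounds); D. Gilbarg, N. S. Trudinger (2001), Thm. 8.10 / 8.17.
-/

noncomputable section

open MeasureTheory TopologicalSpace Set Function Filter Topology InnerProductSpace Real Metric
open scoped RealInnerProductSpace ENNReal NNReal ContDiff

namespace Summit.NavierStokesRegularity.NavierStokesRegularity.Theorems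

open Literature.Analysis.FluidPDE Literature.Analysis.FluidPDE.PineauVicol2026
open scoped Laplacian

/-- `‖α • J‖ ≤ |α|` for the infinitesimal rotation `J = rotGenL` (`‖J y‖ ≤ ‖y‖`). [folklore] -/
theorem norm_smul_rotGenL_le (α : ℝ) : ‖(α • rotGenL)‖ ≤ |α| := by
  refine ContinuousLinearMap.opNorm_le_bound _ (abs_nonneg _) fun x => ?_
  rw [_root_.FunLike.coe_smul, Pi.smul_apply, rotGenL_apply, norm_smul, Real.norm_eq_abs]
  exact mul_le_mul_of_nonneg_left (norm_rotGen_le x) (abs_nonneg _)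

/-- `α • rotGenL` is skew. [folklore] -/
theorem inner_smul_rotGenL_self (α : ℝ) (v : EuclideanSpace ℝ (Fin 3)) : ⟪(α • rotGenL) v, v⟫ = 0 := by
  rw [_root_.FunLike.coe_smul, Pi.smul_apply, rotGenL_apply, real_inner_smul_left, inner_rotGen_self, mul_zero]

/-- Completing the square: `e^{−r²/16 + b r + c} ≤ e^{c + 8 b²} e^{−r²/32}`. [folklore] -/
theorem exp_quadratic_le (r b c : ℝ) :
    Real.exp (-(1 / 16 : ℝ) * r ^ 2 + b * r + c) ≤ Real.exp (c + 8 * b ^ 2) * Real.exp (-(1 / 32 : ℝ) * r ^ 2) := by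
  rw [← Real.exp_add]
  apply Real.exp_le_exp.2
  nlinarith [sq_nonneg (r - 16 * b)]

/-- `(t + 2)^k ≤ e^{k (t + 1)}` for `t ≥ 0`. [folklore] -/
theorem add_two_pow_le_exp {t : ℝ} (ht : 0 ≤ t) (k : ℕ) : (t + 2) ^ k ≤ Real.exp (k * (t + 1)) := by
  have h1 : t + 2 ≤ Real.exp (t + 1) := by linarith [Real.add_one_le_exp (t + 1)]
  have h2 : (t + 2) ^ k ≤ Real.exp (t + 1) ^ k := pow_le_pow_left₀ (by linarith) h1 k
  rwa [← Real.exp_nat_mul] at h2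

variable {U : EuclideanSpace ℝ (Fin 3) → EuclideanSpace ℝ (Fin 3)} {C₀ : ℝ}

/-- **Gaussian gradient bound for the rotating conjugate density.** For the positive smooth
solution `v` of `N v = 0` (drift `½y + (U − αJ)`), with `‖DU‖ ≤ K` and the upper bound
`v(z) ≤ V_b e^{3|z|²/16}`: `γ(y)(‖Dv(y)‖ + ½|y| v(y)) ≤ M₂ e^{−|y|²/32}` for some `M₂`.
[cite: PineauVicol2026, Prop. 5.1 (C² weight with Gaussian bounds (5.3))] -/
theorem exists_gaussian_gradient_bound (h : DriftHyp U C₀) (α : ℝ) {K : ℝ} (hK : ∀ y, ‖fderiv ℝ U y‖ ≤ K)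
    {v : EuclideanSpace ℝ (Fin 3) → ℝ} (hv : ContDiff ℝ ∞ v) (hvpos : ∀ y, 0 < v y)
    (hN : ∀ y, adjN (fun z : EuclideanSpace ℝ (Fin 3) => (1 / 2 : ℝ) • z + (U z - (α • rotGenL) z)) v y = 0)
    {Vb : ℝ} (hVb : ∀ z, v z ≤ Vb * Real.exp ((3 / 16 : ℝ) * ‖z‖ ^ 2)) :
    ∃ M₂ : ℝ, ∀ y, gaussWeight y * ‖fderiv ℝ v y‖ + gaussWeight y * ((1 / 2 : ℝ) * ‖y‖ * v y) ≤
      M₂ * Real.exp (-(1 / 32 : ℝ) * ‖y‖ ^ 2) := by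
  set J : EuclideanSpace ℝ (Fin 3) →L[ℝ] EuclideanSpace ℝ (Fin 3) := α • rotGenL with hJdef
  have hJ : ∀ w, ⟪J w, w⟫ = 0 := inner_smul_rotGenL_self α
  have hJn : ‖J‖ ≤ |α| := norm_smul_rotGenL_le α
  clear_value J
  have hC₀ := h.nonneg
  have hK0 : 0 ≤ K := (norm_nonneg _).trans (hK 0)
  have hVb0 : 0 < Vb := by
    have h0 := hVb 0
    rw [norm_zero] at h0
    have : Real.exp ((3 / 16 : ℝ) * (0 : ℝ) ^ 2) = 1 := by norm_num
    rw [this, mul_one] at h0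
    exact (hvpos 0).trans_le h0
  obtain ⟨Cg, hCg, hgrad⟩ := sq_norm_fderiv_le_of_laplacian_eq
  -- the equation in non-divergence form
  set βv : EuclideanSpace ℝ (Fin 3) → EuclideanSpace ℝ (Fin 3) := fun z => (1 / 2 : ℝ) • z - (U z - J z) with hβv
  set c : EuclideanSpace ℝ (Fin 3) → ℝ := fun z => ⟪U z - J z, z⟫ / 2 with hcdef
  have hU's : ContDiff ℝ ∞ (fun z => U z - J z) := h.contDiff.sub J.contDiff
  have hβvs : ContDiff ℝ ∞ βv := (contDiff_id.const_smul (1 / 2 : ℝ)).sub hU's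
  have hcs : ContDiff ℝ ∞ c := (hU's.inner ℝ contDiff_id).div_const 2
  have hΔ : ∀ z, (Δ v) z = fderiv ℝ v z (βv z) + c z * v z := by
    intro z
    have e := v_equation_rot h hJ (hv.of_le (by norm_cast)) hN z
    simp only [hβv, hcdef]
    linarith
  -- local sizes
  set b₀ : ℝ := C₀ + 1 + |α| with hb₀
  set l₀ : ℝ := K + C₀ + 1 + 2 * |α| with hl₀
  have hb₀1 : 1 ≤ b₀ := by rw [hb₀]; have := abs_nonneg α; linarith
  have hl₀0 : 0 ≤ l₀ := by rw [hl₀]; positivity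
  -- derivative bounds for the coefficients (global)
  have hUd : Differentiable ℝ U := h.contDiff_one.differentiable one_ne_zero
  have hDβ : ∀ z, ‖fderiv ℝ βv z‖ ≤ 1 / 2 + K + |α| := by
    intro z
    have hd : fderiv ℝ βv z = (1 / 2 : ℝ) • ContinuousLinearMap.id ℝ _ - (fderiv ℝ U z - J) := by
      have hid : DifferentiableAt ℝ (fun w : EuclideanSpace ℝ (Fin 3) => w) z := differentiableAt_id
      have hd1 : DifferentiableAt ℝ (fun w : EuclideanSpace ℝ (Fin 3) => (1 / 2 : ℝ) • w) z :=
        (differentiableAt_const (1 / 2 : ℝ)).smul hid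
      have hd2 : DifferentiableAt ℝ (fun w => U w - J w) z := (hUd z).sub J.differentiableAt
      simp only [hβv]
      rw [fderiv_fun_sub hd1 hd2, fderiv_fun_const_smul hid, fderiv_fun_id, fderiv_fun_sub (hUd z) J.differentiableAt,
        ContinuousLinearMap.fderiv]
    rw [hd]
    calc ‖(1 / 2 : ℝ) • ContinuousLinearMap.id ℝ (EuclideanSpace ℝ (Fin 3)) - (fderiv ℝ U z - J)‖
        ≤ ‖(1 / 2 : ℝ) • ContinuousLinearMap.id ℝ (EuclideanSpace ℝ (Fin 3))‖ + ‖fderiv ℝ U z - J‖ := norm_sub_le _ _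
      _ ≤ 1 / 2 + (K + |α|) := by
          refine add_le_add ?_ ((norm_sub_le _ _).trans (add_le_add (hK z) hJn))
          rw [norm_smul, Real.norm_eq_abs, abs_of_pos (by norm_num : (0:ℝ) < 1 / 2)]
          have := ContinuousLinearMap.norm_id_le (𝕜 := ℝ) (E := EuclideanSpace ℝ (Fin 3))
          linarith
      _ = 1 / 2 + K + |α| := by ring
  have hDc : ∀ z, ‖fderiv ℝ c z‖ ≤ (1 / 2) * ((K + |α|) * ‖z‖ + (C₀ + |α| * ‖z‖)) := by
    intro z
    have hfd : DifferentiableAt ℝ (fun z => U z - J z) z := (hUd z).sub J.differentiableAt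
    have hid : DifferentiableAt ℝ (fun w : EuclideanSpace ℝ (Fin 3) => w) z := differentiableAt_id
    have hgd : DifferentiableAt ℝ (fun w => ⟪U w - J w, w⟫) z := hfd.inner ℝ hid
    have e : c = fun w => (1 / 2 : ℝ) * ⟪U w - J w, w⟫ := by funext w; simp only [hcdef]; ring
    rw [e, fderiv_const_mul hgd, norm_smul, Real.norm_eq_abs, abs_of_pos (by norm_num : (0:ℝ) < 1 / 2)]
    refine mul_le_mul_of_nonneg_left ?_ (by norm_num)
    refine ContinuousLinearMap.opNorm_le_bound _ (by positivity) fun w => ?_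
    rw [fderiv_inner_apply ℝ hfd hid, fderiv_fun_id, Real.norm_eq_abs]
    have hDUJ : fderiv ℝ (fun z => U z - J z) z = fderiv ℝ U z - J := by
      rw [fderiv_fun_sub (hUd z) J.differentiableAt, ContinuousLinearMap.fderiv]
    rw [hDUJ]
    have h1 : |⟪U z - J z, (ContinuousLinearMap.id ℝ _) w⟫| ≤ (C₀ + |α| * ‖z‖) * ‖w‖ := by
      rw [ContinuousLinearMap.id_apply]
      calc |⟪U z - J z, w⟫| ≤ ‖U z - J z‖ * ‖w‖ := abs_real_inner_le_norm _ _
        _ ≤ (C₀ + |α| * ‖z‖) * ‖w‖ := by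
            refine mul_le_mul_of_nonneg_right ((norm_sub_le _ _).trans (add_le_add (h.norm_le z) ?_)) (norm_nonneg _)
            exact (J.le_opNorm z).trans (mul_le_mul_of_nonneg_right hJn (norm_nonneg _))
    have h2 : |⟪(fderiv ℝ U z - J) w, z⟫| ≤ (K + |α|) * ‖z‖ * ‖w‖ := by
      calc |⟪(fderiv ℝ U z - J) w, z⟫| ≤ ‖(fderiv ℝ U z - J) w‖ * ‖z‖ := abs_real_inner_le_norm _ _
        _ ≤ (‖fderiv ℝ U z - J‖ * ‖w‖) * ‖z‖ := mul_le_mul_of_nonneg_right (ContinuousLinearMap.le_opNorm _ _) (norm_nonneg _)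
        _ ≤ ((K + |α|) * ‖w‖) * ‖z‖ := by
            refine mul_le_mul_of_nonneg_right (mul_le_mul_of_nonneg_right ?_ (norm_nonneg _)) (norm_nonneg _)
            exact (norm_sub_le _ _).trans (add_le_add (hK z) hJn)
        _ = (K + |α|) * ‖z‖ * ‖w‖ := by ring
    calc |⟪U z - J z, (ContinuousLinearMap.id ℝ _) w⟫ + ⟪(fderiv ℝ U z - J) w, z⟫|
        ≤ |⟪U z - J z, (ContinuousLinearMap.id ℝ _) w⟫| + |⟪(fderiv ℝ U z - J) w, z⟫| := abs_add_le _ _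
      _ ≤ (C₀ + |α| * ‖z‖) * ‖w‖ + (K + |α|) * ‖z‖ * ‖w‖ := add_le_add h1 h2
      _ = ((K + |α|) * ‖z‖ + (C₀ + |α| * ‖z‖)) * ‖w‖ := by ring
  -- the constant
  set A₁ : ℝ := Real.sqrt Cg * ((1 + l₀) * b₀ ^ 3) * Vb with hA₁
  set M₂ : ℝ := A₁ * Real.exp ((4 + 3 / 16 : ℝ) + 8 * (4 + 3 / 8 : ℝ) ^ 2) + Vb * Real.exp (0 + 8 * (1 : ℝ) ^ 2) with hM₂
  refine ⟨M₂, fun y => ?_⟩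
  set r : ℝ := ‖y‖ with hr
  have hr0 : 0 ≤ r := norm_nonneg _
  -- sizes on `B̄(y, 1)`
  set B : ℝ := b₀ * (r + 1) with hB
  set Λ : ℝ := l₀ * (r + 2) with hΛ
  set S : ℝ := Vb * Real.exp ((3 / 16 : ℝ) * (r + 1) ^ 2) with hS
  have hB1 : 1 ≤ B := by rw [hB]; nlinarith
  have hΛ0 : 0 ≤ Λ := by rw [hΛ]; positivity
  have hzn : ∀ z ∈ closedBall y 1, ‖z‖ ≤ r + 1 := fun z hz => by
    rw [mem_closedBall, dist_eq_norm] at hz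
    have := norm_le_norm_add_norm_sub' z y
    rw [← hr] at this
    linarith [norm_sub_rev z y]
  clear_value r B Λ S b₀ l₀ A₁ M₂
  have hα0 : 0 ≤ |α| := abs_nonneg α
  have hβB : ∀ z ∈ closedBall y 1, ‖βv z‖ ≤ B := by
    intro z hz
    have hz1 := hzn z hz
    have t1 : (1 / 2 : ℝ) * ‖z‖ ≤ 1 * (r + 1) := mul_le_mul (by norm_num) hz1 (norm_nonneg _) zero_le_one
    have t2 : |α| * ‖z‖ ≤ |α| * (r + 1) := mul_le_mul_of_nonneg_left hz1 hα0
    have t3 : C₀ ≤ C₀ * (r + 1) := le_mul_of_one_le_right hC₀ (by linarith)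
    calc ‖βv z‖ ≤ ‖(1 / 2 : ℝ) • z‖ + ‖U z - J z‖ := norm_sub_le _ _
      _ ≤ (1 / 2) * ‖z‖ + (C₀ + |α| * ‖z‖) := by
          rw [norm_smul, Real.norm_eq_abs, abs_of_pos (by norm_num : (0:ℝ) < 1 / 2)]
          refine add_le_add le_rfl ((norm_sub_le _ _).trans (add_le_add (h.norm_le z) ?_))
          exact (J.le_opNorm z).trans (mul_le_mul_of_nonneg_right hJn (norm_nonneg _))
      _ ≤ (C₀ + 1 + |α|) * (r + 1) := by linarith
      _ = B := by rw [hB, hb₀]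
  have hcB : ∀ z ∈ closedBall y 1, |c z| ≤ B ^ 2 := by
    intro z _
    have h1 : |c z| ≤ C₀ / 2 := by
      simp only [hcdef]
      rw [abs_div, abs_two, inner_sub_left, hJ z, sub_zero]
      exact div_le_div_of_nonneg_right (h.abs_inner_le z) (by norm_num)
    have h2 : C₀ / 2 ≤ B := by
      have t3 : C₀ ≤ (C₀ + 1 + |α|) * (r + 1) :=
        (le_mul_of_one_le_right hC₀ (by linarith : (1:ℝ) ≤ r + 1)).trans
          (mul_le_mul_of_nonneg_right (by linarith) (by linarith))
      rw [hB, hb₀]; linarith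
    exact h1.trans (h2.trans (le_self_pow₀ hB1 two_ne_zero))
  have hl₀r : (1 : ℝ) * l₀ ≤ (r + 2) * l₀ := mul_le_mul_of_nonneg_right (by linarith) hl₀0
  have hβΛ : ∀ z ∈ closedBall y 1, ‖fderiv ℝ βv z‖ ≤ Λ := by
    intro z _
    refine (hDβ z).trans ?_
    have : 1 / 2 + K + |α| ≤ l₀ := by rw [hl₀]; linarith
    rw [hΛ]; linarith
  have hcΛ : ∀ z ∈ closedBall y 1, ‖fderiv ℝ c z‖ ≤ Λ := by
    intro z hz
    have hz2 : ‖z‖ ≤ r + 2 := by linarith [hzn z hz]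
    refine (hDc z).trans ?_
    have t1 : (K + |α|) * ‖z‖ ≤ (K + |α|) * (r + 2) := mul_le_mul_of_nonneg_left hz2 (by positivity)
    have t2 : |α| * ‖z‖ ≤ |α| * (r + 2) := mul_le_mul_of_nonneg_left hz2 hα0
    have t3 : C₀ ≤ C₀ * (r + 2) := le_mul_of_one_le_right hC₀ (by linarith)
    have t4 : (1 / 2 : ℝ) * ((K + |α|) * (r + 2) + (C₀ * (r + 2) + |α| * (r + 2))) ≤ l₀ * (r + 2) := by
      have e : (1 / 2 : ℝ) * ((K + |α|) * (r + 2) + (C₀ * (r + 2) + |α| * (r + 2))) =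
          ((1 / 2 : ℝ) * (K + C₀ + 2 * |α|)) * (r + 2) := by ring
      rw [e]
      exact mul_le_mul_of_nonneg_right (by rw [hl₀]; linarith) (by linarith)
    rw [hΛ]
    linarith
  have hvS : ∀ z ∈ closedBall y 1, |v z| ≤ S := by
    intro z hz
    rw [abs_of_pos (hvpos z), hS]
    refine (hVb z).trans (mul_le_mul_of_nonneg_left (Real.exp_le_exp.2 ?_) hVb0.le)
    exact mul_le_mul_of_nonneg_left (pow_le_pow_left₀ (norm_nonneg _) (hzn z hz) 2) (by norm_num)
  have key := hgrad v βv c y B Λ S hv hβvs hcs hΔ hB1 hΛ0 hβB hcB hβΛ hcΛ hvS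
  -- `‖Dv(y)‖ ≤ √Cg (1 + Λ) B³ S`
  have hS0 : 0 ≤ S := by rw [hS]; positivity
  have hDv : ‖fderiv ℝ v y‖ ≤ Real.sqrt Cg * ((1 + Λ) * B ^ 3) * S := by
    have h1 : ‖fderiv ℝ v y‖ ^ 2 ≤ (Real.sqrt Cg * ((1 + Λ) * B ^ 3) * S) ^ 2 := by
      have hΛ2 : (1 + Λ ^ 2) ≤ (1 + Λ) ^ 2 := by
        have e : (1 + Λ) ^ 2 = 1 + Λ ^ 2 + 2 * Λ := by ring
        rw [e]; linarith
      calc ‖fderiv ℝ v y‖ ^ 2 ≤ Cg * (1 + Λ ^ 2) * B ^ 6 * S ^ 2 := key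
        _ ≤ Cg * (1 + Λ) ^ 2 * B ^ 6 * S ^ 2 := by
            have h0 : 0 ≤ Cg * B ^ 6 * S ^ 2 := by positivity
            rw [show Cg * (1 + Λ) ^ 2 * B ^ 6 * S ^ 2 = (1 + Λ) ^ 2 * (Cg * B ^ 6 * S ^ 2) by ring,
              show Cg * (1 + Λ ^ 2) * B ^ 6 * S ^ 2 = (1 + Λ ^ 2) * (Cg * B ^ 6 * S ^ 2) by ring]
            exact mul_le_mul_of_nonneg_right hΛ2 h0
        _ = (Real.sqrt Cg * ((1 + Λ) * B ^ 3) * S) ^ 2 := by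
            rw [mul_pow, mul_pow, mul_pow, Real.sq_sqrt hCg.le]; ring
    have hX0 : 0 ≤ Real.sqrt Cg * ((1 + Λ) * B ^ 3) * S := by positivity
    exact (pow_le_pow_iff_left₀ (norm_nonneg _) hX0 two_ne_zero).1 h1
  have hγ : gaussWeight y = Real.exp (-(1 / 4 : ℝ) * r ^ 2) := by rw [hr]; exact congrFun gaussWeight_eq y
  have hγ0 : 0 ≤ gaussWeight y := (gaussWeight_pos y).le
  -- first term
  have hpoly : (1 + Λ) * B ^ 3 ≤ (1 + l₀) * b₀ ^ 3 * Real.exp (4 * (r + 1)) := by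
    have h1 : 1 + Λ ≤ (1 + l₀) * (r + 2) := by
      have e : (1 + l₀) * (r + 2) = (r + 2) + l₀ * (r + 2) := by ring
      rw [hΛ, e]; linarith
    have h2 : B ^ 3 ≤ b₀ ^ 3 * (r + 2) ^ 3 := by
      rw [hB, ← mul_pow]
      exact pow_le_pow_left₀ (by positivity) (mul_le_mul_of_nonneg_left (by linarith) (by positivity)) 3
    have h3 : (r + 2) ^ 4 ≤ Real.exp (4 * (r + 1)) := by
      have := add_two_pow_le_exp hr0 4
      norm_num at this
      exact this
    calc (1 + Λ) * B ^ 3 ≤ ((1 + l₀) * (r + 2)) * (b₀ ^ 3 * (r + 2) ^ 3) :=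
          mul_le_mul h1 h2 (by positivity) (by positivity)
      _ = (1 + l₀) * b₀ ^ 3 * (r + 2) ^ 4 := by ring
      _ ≤ (1 + l₀) * b₀ ^ 3 * Real.exp (4 * (r + 1)) := mul_le_mul_of_nonneg_left h3 (by positivity)
  have hT1 : gaussWeight y * ‖fderiv ℝ v y‖ ≤
      A₁ * Real.exp (-(1 / 16 : ℝ) * r ^ 2 + (4 + 3 / 8 : ℝ) * r + (4 + 3 / 16 : ℝ)) := by
    have h1 : gaussWeight y * ‖fderiv ℝ v y‖ ≤ gaussWeight y * (Real.sqrt Cg * ((1 + l₀) * b₀ ^ 3 * Real.exp (4 * (r + 1))) * S) := by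
      refine mul_le_mul_of_nonneg_left (hDv.trans ?_) hγ0
      exact mul_le_mul_of_nonneg_right (mul_le_mul_of_nonneg_left hpoly (Real.sqrt_nonneg _)) hS0
    refine h1.trans (le_of_eq ?_)
    rw [hγ, hS, hA₁]
    have e : -(1 / 16 : ℝ) * r ^ 2 + (4 + 3 / 8 : ℝ) * r + (4 + 3 / 16 : ℝ) =
        -(1 / 4 : ℝ) * r ^ 2 + (4 * (r + 1) + (3 / 16 : ℝ) * (r + 1) ^ 2) := by ring
    rw [e, Real.exp_add, Real.exp_add]
    ring
  -- second term
  have hT2 : gaussWeight y * ((1 / 2 : ℝ) * r * v y) ≤ Vb * Real.exp (-(1 / 16 : ℝ) * r ^ 2 + 1 * r + 0) := by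
    have h1 : (1 / 2 : ℝ) * r ≤ Real.exp r := by linarith [Real.add_one_le_exp r]
    have h2 : v y ≤ Vb * Real.exp ((3 / 16 : ℝ) * r ^ 2) := by rw [hr]; exact hVb y
    have h3 : (1 / 2 : ℝ) * r * v y ≤ Real.exp r * (Vb * Real.exp ((3 / 16 : ℝ) * r ^ 2)) :=
      mul_le_mul h1 h2 (hvpos y).le (Real.exp_pos _).le
    refine (mul_le_mul_of_nonneg_left h3 hγ0).trans (le_of_eq ?_)
    rw [hγ]
    have e : -(1 / 16 : ℝ) * r ^ 2 + 1 * r + 0 = -(1 / 4 : ℝ) * r ^ 2 + (r + (3 / 16 : ℝ) * r ^ 2) := by ring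
    rw [e, Real.exp_add, Real.exp_add]
    ring
  have hA₁0 : 0 ≤ A₁ := by rw [hA₁]; positivity
  calc gaussWeight y * ‖fderiv ℝ v y‖ + gaussWeight y * ((1 / 2 : ℝ) * r * v y)
      ≤ A₁ * Real.exp (-(1 / 16 : ℝ) * r ^ 2 + (4 + 3 / 8 : ℝ) * r + (4 + 3 / 16 : ℝ)) +
          Vb * Real.exp (-(1 / 16 : ℝ) * r ^ 2 + 1 * r + 0) := add_le_add hT1 hT2
    _ ≤ A₁ * (Real.exp ((4 + 3 / 16 : ℝ) + 8 * (4 + 3 / 8 : ℝ) ^ 2) * Real.exp (-(1 / 32 : ℝ) * r ^ 2)) +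
          Vb * (Real.exp (0 + 8 * (1 : ℝ) ^ 2) * Real.exp (-(1 / 32 : ℝ) * r ^ 2)) :=
        add_le_add (mul_le_mul_of_nonneg_left (exp_quadratic_le r _ _) hA₁0)
          (mul_le_mul_of_nonneg_left (exp_quadratic_le r _ _) hVb0.le)
    _ = M₂ * Real.exp (-(1 / 32 : ℝ) * r ^ 2) := by rw [hM₂]; ring

/-- **Registered form (B2 tool stub `rotatingDensity_gradientBound`, `ℝ³`, `J = α • rotGenL`):** the
Gaussian gradient bound `γ(‖Dv‖ + ½|y| v) ≤ M₂ e^{−|y|²/32}`. [cite: PineauVicol2026, Prop. 5.1 (C² weight with Gaussian bounds (5.3))] -/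
theorem rotatingDensity_gradientBound :
    ∀ (U : EuclideanSpace ℝ (Fin 3) → EuclideanSpace ℝ (Fin 3)) (C₀ α K : ℝ), Literature.Analysis.FluidPDE.PineauVicol2026.DriftHyp U C₀ → (∀ y, ‖fderiv ℝ U y‖ ≤ K) → ∀ v : EuclideanSpace ℝ (Fin 3) → ℝ, ContDiff ℝ (⊤ : ℕ∞) v → (∀ y, 0 < v y) → (∀ y : EuclideanSpace ℝ (Fin 3), Literature.Analysis.FluidPDE.PineauVicol2026.adjN (fun z => (1 / 2 : ℝ) • z + (U z - α • Literature.Analysis.FluidPDE.rotGen z)) v y = 0) → ∀ Vb : ℝ, (∀ z, v z ≤ Vb * Real.exp ((3 / 16 : ℝ) * ‖z‖ ^ 2)) → ∃ M₂ : ℝ, ∀ y : EuclideanSpace ℝ (Fin 3), Literature.Analysis.FluidPDE.PineauVicol2026.gaussWeight y * ‖fderiv ℝ v y‖ + Literature.Analysis.FluidPDE.PineauVicol2026.gaussWeight y * ((1 / 2 : ℝ) * ‖y‖ * v y) ≤ M₂ * Real.exp (-(1 / 32 : ℝ) * ‖y‖ ^ 2) := by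
  intro U C₀ α K h hK v hv hvpos hN Vb hVb
  exact exists_gaussian_gradient_bound h α hK hv hvpos hN hVb

end Summit.NavierStokesRegularity.NavierStokesRegularity.Theorems
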